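import Literature.NumberTheory.EllipticCurves.DeShalitThetaTExpansionColemanValues
import Literature.NumberTheory.EllipticCurves.FormalGroupLubinTateDivisionPointsTateUnit
import HarnessLib

/-!
# The bridge identity `g_β = (G ∘ [1]_{P′,f}) ∘ [a]_f` from de Shalit's DIVISION POINTS: the Tate-module unit `a` supplied by
# coherent torsion points of the lane curve (de Shalit II.4.4 (iv) + II.4.9 (ii), assembled — proofs only)

Topic `NumberTheory/EllipticCurves` (theorems only; no definition, no named fact, no instance).  Cell `bsd-print-cf2`, width seat
`bsd-line-cf2c-w4` g15, brick B10b of the memo `ALPHA-ASSEMBLY-w4g15.md`: the composition of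
`relColemanSeries_eq_subst_subst_of_semiconj` (`DeShalitThetaTExpansionColemanValues`: the bridge from levelwise chart identities at the
parameters `t_m = h([a]_f ω_{m+1})`) with `exists_unit_forall_ptOfZ_hom_hom_cohPt_eq` (`FormalGroupLubinTateDivisionPointsTateUnit`: the unit
`a` from coherent torsion points `U_m ∈ E₁(M_m)` of exact order `p^{m+1}`).  The result no longer mentions `a` in its hypotheses:

* ★★★ `exists_unit_relColemanSeries_eq_subst_subst_of_divisionPoints` — for the lane datum at a place of degree one
  (`e : 𝒪[F] ≃+* ℤ_p`, `V/ℤ_p` ordinary with `V̂ = F_P`, `p = ϖπ_ℤ`, `q = 2`, `E ⊆ F^{nr}`, `σ₀`), a unit `β ∈ 𝒰_E`, ONE presentation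
  `G = ψ(Q_R(x₀, y₀; x_c; K))` of a series `G ∈ 𝒪_E⟦X⟧` as an algebraic theta `t`-expansion over a ring `R` with a semiconjugating
  endomorphism `τ` (`φ⁻¹ ∘ ψ = ψ ∘ τ`, `W_R^τ = W_R`, `τK = K`, `τ` permutes the `x_c`), and LEVELWISE: points `U_m` of the lane curve
  `V ⊗ LTCoeff F` over `M_m = E·K_π^{m+1}` in the kernel of reduction, of order `p^{m+1}`, `[π]_{P′}`-coherent, with the CHART identity
  `(ψτ^{m+1}x₀, ψτ^{m+1}y₀) − U_m = (x_R^{(m)}, y_R^{(m)})` and the VALUE identity `ψK·∏((x_R^{(m)} − ψx_c)⁻¹)⁶ = β_m`: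
  **`∃ a ∈ 𝒪_Fˣ, relColemanSeries β = (G ∘ [1]_{P′,f}) ∘ [a]_f`** — the hypothesis (hβ) of the cell's
  `KatzMeasureJZeroSeam.map_relCoatesWiles_eq_of_bridge`, with its `a`.

With `U_m = ι_v(σ_𝔭^{-(m+1)}ξ(Ω) − ξ(Ω/ψ(𝔭)^{m+1}))` (bricks B1/B4/B6/B9/B-lat) and the value identity from `IsThetaValueOne`
(`thetaAlg_eq_of_isThetaValueOne`) this is de Shalit II §4.9 (ii) «`g_{e(𝔞)} = Q`» for the family units of the seam.
No summit statement is proved; BSD is not proved by any of this.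

## References
* [deShalit1987] E. de Shalit, *Iwasawa theory of elliptic curves with complex multiplication* (1987), I §2.2 Theorem, II §4.4 (iv), (12),
  II §4.9 Proposition (ii) and proof (p. 63).
* [CasselsFrohlichANT1967] J.-P. Serre, *Local class field theory* (Cassels–Fröhlich Ch. VI), §3.5–3.6.
-/

noncomputable section

open scoped Classical
open PowerSeries

namespace Literature.NumberTheory.EllipticCurves

open ValuativeRel Literature.NumberTheory.GaloisRepresentations
  Literature.NumberTheory.GaloisRepresentations.IsNonarchimedeanLocalField
  Literature.NumberTheory.GaloisRepresentations.LubinTate Field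
open Literature.NumberTheory.EllipticCurves.FormalGroupChart _root_.WeierstrassCurve

section Bridge

variable {F : Type} [Field F] [ValuativeRel F] [TopologicalSpace F] [IsNonarchimedeanLocalField F]

attribute [local instance] ltNormUniformSpace ltNormIsUniformAddGroup rk1 nF nE fintypeResidueField

variable {p : ℕ} [Fact p.Prime] (e : 𝒪[F] ≃+* ℤ_[p]) (hq : residueFieldCard F = p)
  {π : 𝒪[F]} (hπ : (valuation F).IsUniformizer (π : F)) {πZ : ℤ_[p]} (he : e π = πZ)
  (hA : IsLTRing πZ p) {P : PowerSeries ℤ_[p]} (hP : IsLTSeries πZ p P)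
  {V : WeierstrassCurve ℤ_[p]} (hV : V.formalGroupLaw = ltF hA hP) {ϖ : ℤ_[p]} (hp : (p : ℤ_[p]) = ϖ * πZ) (hϖ : IsUnit ϖ)
  (E : IntermediateField F (AlgebraicClosure F)) [FiniteDimensional F E] [Normal F E] [IsGalois F E]
  (hq2 : residueFieldCard F = 2) (hE : E ≤ maxUnramified F) {σ₀ : absoluteGaloisGroup F} (hσ₀ : IsAbsArithFrob σ₀)

include hV hp hϖ in
set_option maxHeartbeats 800000 in
/-- ★★★ **`∃ a, g_β = (G ∘ [1]_{P′,f}) ∘ [a]_f` from de Shalit's division points** (see the module docstring for the hypotheses; the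
parameter-level hypotheses of `relColemanSeries_eq_subst_subst_of_semiconj` — (ht0), (he) at `t_m = h([a]_f ω_{m+1})` — are replaced by
point-level ones on `U_m`: kernel membership, `addOrderOf U_m = p^{m+1}`, `[π]_{P′} z(U_{m+1}) = ι z(U_m)`, `U_m ≠ O`-free since the order is
`p^{m+1} ≥ 2`, and the chart identity AT `U_m`).
[cite: deShalit1987, I §2.2 Theorem, II §4.4 (iv), (12), II §4.9 Proposition (ii)] [cite: CasselsFrohlichANT1967, Ch. VI §3.5–3.6] -/
theorem exists_unit_relColemanSeries_eq_subst_subst_of_divisionPoints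
    [hEll : ∀ m : ℕ, (curveOver (E ⊔ ltField π m : IntermediateField F (AlgebraicClosure F))
      (V.map ((LTCoeff.of F).toRingHom.comp e.symm.toRingHom))).IsElliptic]
    (β : RelNormCoherentUnits hπ E) (G : PowerSeries (unitBall E))
    {R : Type*} [CommRing R] (ψ : R →+* unitBall E) (WR : WeierstrassCurve R)
    (hWR : WR.map ψ = (V.map ((LTCoeff.of F).toRingHom.comp e.symm.toRingHom)).map (algebraMap (LTCoeff F) (unitBall E)))
    {ι : Type*} (T : Finset ι) (Kc x₀ y₀ : R) (x : ι → R) (u : ι → Rˣ) (hu : ∀ c ∈ T, (u c : R) = x₀ - x c)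
    (hG₀ : G = PowerSeries.map ψ (C Kc * ∏ c ∈ T,
        PowerSeries.invOfUnit ((WR.translateX x₀ y₀).subst WR.formalNeg - C (x c)) (u c) ^ 6))
    (τ : R →+* R) (hτ : ((frobUnitBall E σ₀).symm : unitBall E →+* unitBall E).comp ψ = ψ.comp τ)
    (hWτ : WR.map τ = WR) (hKτ : τ Kc = Kc) (eι : ι → ι) (heT : ∀ c ∈ T, eι c ∈ T) (hinj : Set.InjOn eι T)
    (hsurj : Set.SurjOn eι T T) (hx : ∀ c ∈ T, τ (x c) = x (eι c))
    -- de Shalit's division points on the lane curve, levelwise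
    (U : ∀ m : ℕ, (curveOver (E ⊔ ltField π m : IntermediateField F (AlgebraicClosure F))
      (V.map ((LTCoeff.of F).toRingHom.comp e.symm.toRingHom))).toAffine.Point)
    (hU : ∀ m : ℕ, U m ∈ kernel (NormedField.valuation (K := (E ⊔ ltField π m : IntermediateField F (AlgebraicClosure F))))
      (curveOver (E ⊔ ltField π m : IntermediateField F (AlgebraicClosure F)) (V.map ((LTCoeff.of F).toRingHom.comp e.symm.toRingHom))))
    (hord : ∀ m : ℕ, addOrderOf (U m) = p ^ (m + 1))
    (hcoh : ∀ m : ℕ, ltSMul (maxNilIdeal F (E ⊔ ltField π (m + 1) : IntermediateField F (AlgebraicClosure F))) (isLTRing_LTCoeff hπ)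
        (isLTSeries_map_LTCoeff_of_degree_one e hq he hP) (LTCoeff.of F π) (zPt (U (m + 1)) (hU (m + 1))) =
      inclPt (sup_le_sup_left (ltField_mono hπ (Nat.le_succ m)) E) (zPt (U m) (hU m)))
    -- the chart identity at `U_m` and the value identity
    (xR yR : (m : ℕ) → ↥(E ⊔ ltField π m : IntermediateField F (AlgebraicClosure F)))
    (h₀ : ∀ m : ℕ, (curveOver (E ⊔ ltField π m : IntermediateField F (AlgebraicClosure F))
        (V.map ((LTCoeff.of F).toRingHom.comp e.symm.toRingHom))).toAffine.Nonsingular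
      (((inclUnitBall (F := F) (le_sup_left : E ≤ E ⊔ ltField π m) (ψ (τ^[m + 1] x₀)) :
        unitBall (E ⊔ ltField π m : IntermediateField F (AlgebraicClosure F))) : (E ⊔ ltField π m : IntermediateField F _)))
      (((inclUnitBall (F := F) (le_sup_left : E ≤ E ⊔ ltField π m) (ψ (τ^[m + 1] y₀)) :
        unitBall (E ⊔ ltField π m : IntermediateField F (AlgebraicClosure F))) : (E ⊔ ltField π m : IntermediateField F _))))
    (hR : ∀ m : ℕ, (curveOver (E ⊔ ltField π m : IntermediateField F (AlgebraicClosure F))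
      (V.map ((LTCoeff.of F).toRingHom.comp e.symm.toRingHom))).toAffine.Nonsingular (xR m) (yR m))
    (hpt : ∀ m : ℕ, (.some _ _ (h₀ m) : (curveOver (E ⊔ ltField π m : IntermediateField F (AlgebraicClosure F))
        (V.map ((LTCoeff.of F).toRingHom.comp e.symm.toRingHom))).toAffine.Point) - U m = .some _ _ (hR m))
    (hval : ∀ m : ℕ, ((inclUnitBall (F := F) (le_sup_left : E ≤ E ⊔ ltField π m) (ψ Kc) :
        unitBall (E ⊔ ltField π m : IntermediateField F (AlgebraicClosure F))) : (E ⊔ ltField π m : IntermediateField F _)) *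
        ∏ c ∈ T, ((xR m - (((inclUnitBall (F := F) (le_sup_left : E ≤ E ⊔ ltField π m) (ψ (x c)) :
          unitBall (E ⊔ ltField π m : IntermediateField F (AlgebraicClosure F))) : (E ⊔ ltField π m : IntermediateField F _))))⁻¹) ^ 6 =
      ((β.val m : unitBall (E ⊔ ltField π m : IntermediateField F (AlgebraicClosure F))) :
        (E ⊔ ltField π m : IntermediateField F (AlgebraicClosure F)))) :
    ∃ a : 𝒪[F]ˣ, relColemanSeries hπ E hq2 hE hσ₀ β =
      PowerSeries.subst ((hom (isLTRing_LTCoeff hπ) (isLTSeries_LTCoeff _) (isLTSeries_LTCoeff _) (LTCoeff.of F (a : 𝒪[F]))).map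
          (algebraMap (LTCoeff F) (unitBall E)))
        (PowerSeries.subst ((hom (isLTRing_LTCoeff hπ) (isLTSeries_map_LTCoeff_of_degree_one e hq he hP) (isLTSeries_LTCoeff _) 1).map
          (algebraMap (LTCoeff F) (unitBall E))) G) := by
  obtain ⟨a, ha⟩ := exists_unit_forall_ptOfZ_hom_hom_cohPt_eq e hq hπ he hA hP hV hp hϖ E U hU hord hcoh
  refine ⟨a, relColemanSeries_eq_subst_subst_of_semiconj hπ E hq2 hE hσ₀ β G (constantCoeff_hom _ _ _ 1) (constantCoeff_hom _ _ _ _)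
    (V.map ((LTCoeff.of F).toRingHom.comp e.symm.toRingHom)) (fun m => hEll m) ψ WR hWR T Kc x₀ y₀ x u hu hG₀ τ hτ hWτ hKτ eι heT
    hinj hsurj hx (fun m => ?_) xR yR h₀ hR (fun m _ => ?_) hval⟩
  · -- the parameter is non-zero: `P(t_m) = U_m` has order `p^{m+1} ≠ 1`
    intro h0
    have h1 : U m = 0 := by rw [← ha m, ptOfZ_of_eq_zero h0]
    have h2 := hord m
    rw [h1, addOrderOf_zero] at h2
    exact absurd h2.symm (ne_of_gt (one_lt_pow₀ (Nat.Prime.one_lt Fact.out) (Nat.succ_ne_zero m)))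
  · rw [ha m]
    exact hpt m

end Bridge

end Literature.NumberTheory.EllipticCurves

end
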